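import Summits.AtomisticToContinuum.Crystallization.Theorems.PalmUnimodularRigidityLayeredLawsSelectHcpCertificateDefs
import Summits.AtomisticToContinuum.Crystallization.Theorems.PalmUnimodularRigidityLayeredLawsSelectHcpRootedChartUnique
import Summits.AtomisticToContinuum.Crystallization.Theorems.LayeredLawsSelectHcp.Negative.HcpShells

/-!
# Crux `LayeredLawsSelectHcp` (stmt-AtomisticToContinuum-9226), line `mtp-prestress-split-ergodic-frame`:
# the labelled star of a rooted chart is near a rotated scaled ideal star (`tube_chartStarFrame`)

Registered sub-goal `tube_chartStarFrame` (G3a of the far-field memo `Cruxes/LayeredLawsSelectHcp/LeadC3FarField.md`,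
§5–§6): the base case of the quantitative near-rigidity of rooted charts.  For a rooted labelled chart `X` of an
every-point-good configuration `S`, the twelve star atoms `X v`, `v ∈ hcpStarIdx`, are LABEL BY LABEL within `a/100`
of `a • A (Pᵢ v)` (`Pᵢ = hcpSite 1 √(2/3)`, the ideal hcp sites) for the scale `a ∈ [9/10, 1]` of the good shell of
the root and ONE linear isometry `A`.

`GoodShell S 0` only gives an UNLABELLED matching of the shell of the root with a rotated scaled fcc OR hcp kissing
pattern.  We align it with the chart:

* `matched_labels`: the chart's star atoms lie in the shell (bonds `≤ 28/25 ≤ 5a/4`), so composing the chart with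
  the matching gives an injection `φ : hcpStarIdx → pattern` which is a CONTACT-GRAPH ISOMORPHISM onto its image:
  bonded labels (`dist ≤ 28/25`) go to pattern points `< √2` apart, hence touching (pattern distances are `1` or
  `≥ √2`, `dist_eq_one_of_mem_scaledPattern`, integer arithmetic by `decide`), and non-bonded labels (`dist > 28/25`,
  charts are injective) to points `> 1` apart;
* the fcc pattern is then impossible (`fcc_edge_one_triangle`): in the ideal hcp star the edge `{(0,1,0), (0,0,1)}`
  lies in the two triangles through `(±1,0,0)`, while in the cuboctahedron every edge lies in exactly one triangle
  (by `decide` on `fccInt`);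
* for the hcp pattern, the hex↔cubic isometry `hexIso` carries the pattern onto the ideal star
  (`exists_label_of_mem_hcpKissingPattern`, from `HcpShells.hexIso_hcpPattern`), so `φ` induces a touching-preserving
  injection of `hcpStarIdx` into itself, hence an isometry of the ideal star (`stub_localCongruenceStarAut`); a linear
  isometry `R` with `R (Pᵢ v) = φ v` is read off three independent struts (`exists_linearIsometry_of_inner_eq`, as in
  the landed `exists_frame`), and `A ∘ R` is the frame.

All `[folklore]`.
-/

noncomputable section

namespace Summit.AtomisticToContinuum.Crystallization.Theorems.PalmUnimodularRigidity.LayeredLawsSelectHcp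

open MeasureTheory Set
open Literature.MathematicalPhysics.StatisticalMechanics Literature.Geometry.DiscreteGeometry
open Summit.AtomisticToContinuum.Crystallization.Theorems.LayeredLawsSelectHcp.Negative.DiracLaws (GoodShell)
open Summit.AtomisticToContinuum.Crystallization.Theorems.LayeredLawsSelectHcp.Negative.HexCubic (hexIso)
open Summit.AtomisticToContinuum.Crystallization.Theorems.LayeredLawsSelectHcp.Negative.HcpShells
  (hcpOffsetIdx hexIso_hcpPattern)
open scoped RealInnerProductSpace

/-! ## Distances in the two kissing patterns: `1` or at least `√2` -/

/-- In a scaled integer pattern whose difference vectors have squared norm `N` or `≥ 2N`, two distinct points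
`< √2` apart are exactly `1` apart. [folklore] -/
theorem dist_eq_one_of_mem_scaledPattern {Sv : Finset (Fin 3 → ℤ)} {N : ℕ} (hN : N ≠ 0)
    (hS : ∀ v ∈ Sv, ∀ w ∈ Sv, v ≠ w → sqNormInt (v - w) = (N : ℤ) ∨ 2 * (N : ℤ) ≤ sqNormInt (v - w))
    {x y : EuclideanSpace ℝ (Fin 3)} (hx : x ∈ scaledPattern Sv N) (hy : y ∈ scaledPattern Sv N) (hxy : x ≠ y)
    (hlt : dist x y < Real.sqrt 2) : dist x y = 1 := by
  obtain ⟨v, hv, rfl⟩ := Finset.mem_image.1 hx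
  obtain ⟨w, hw, rfl⟩ := Finset.mem_image.1 hy
  have hvw : v ≠ w := fun h => hxy (by rw [h])
  have hpos : (0 : ℝ) < Real.sqrt N := by positivity
  have hd : dist ((Real.sqrt N)⁻¹ • intVec v : EuclideanSpace ℝ (Fin 3)) ((Real.sqrt N)⁻¹ • intVec w) =
      (Real.sqrt N)⁻¹ * Real.sqrt (sqNormInt (v - w) : ℝ) := by
    rw [dist_eq_norm, ← smul_sub, intVec_sub, norm_smul, norm_inv, Real.norm_of_nonneg hpos.le, norm_intVec]
  rcases hS v hv w hw hvw with h | h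
  · rw [hd, h, Int.cast_natCast, inv_mul_cancel₀ hpos.ne']
  · exfalso
    have h' : ((2 * (N : ℤ) : ℤ) : ℝ) ≤ (sqNormInt (v - w) : ℝ) := by exact_mod_cast h
    push_cast at h'
    have h2 : Real.sqrt 2 ≤ (Real.sqrt N)⁻¹ * Real.sqrt (sqNormInt (v - w) : ℝ) := by
      rw [le_inv_mul_iff₀ hpos, ← Real.sqrt_mul (Nat.cast_nonneg N)]
      exact Real.sqrt_le_sqrt (by linarith)
    rw [hd] at hlt
    linarith

/-- Difference vectors of `fccInt` have squared norm `2` or `≥ 4` (by `decide`). [folklore] -/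
theorem sqNormInt_sub_fccInt_dichotomy : ∀ v ∈ fccInt, ∀ w ∈ fccInt, v ≠ w →
    sqNormInt (v - w) = ((2 : ℕ) : ℤ) ∨ 2 * ((2 : ℕ) : ℤ) ≤ sqNormInt (v - w) := by
  decide

/-- Difference vectors of `hcpInt` have squared norm `18` or `≥ 36` (by `decide`). [folklore] -/
theorem sqNormInt_sub_hcpInt_dichotomy : ∀ v ∈ hcpInt, ∀ w ∈ hcpInt, v ≠ w →
    sqNormInt (v - w) = ((18 : ℕ) : ℤ) ∨ 2 * ((18 : ℕ) : ℤ) ≤ sqNormInt (v - w) := by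
  decide

/-- **Distances in the FCC pattern are `1` or `≥ √2`.** [folklore] -/
theorem fcc_dist_eq_one : ∀ x ∈ fccKissingPattern, ∀ y ∈ fccKissingPattern, x ≠ y →
    dist x y < Real.sqrt 2 → dist x y = 1 := fun _ hx _ hy hxy hlt =>
  dist_eq_one_of_mem_scaledPattern two_ne_zero sqNormInt_sub_fccInt_dichotomy hx hy hxy hlt

/-- **Distances in the HCP pattern are `1` or `≥ √2`.** [folklore] -/
theorem hcp_dist_eq_one : ∀ x ∈ hcpKissingPattern, ∀ y ∈ hcpKissingPattern, x ≠ y →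
    dist x y < Real.sqrt 2 → dist x y = 1 := fun _ hx _ hy hxy hlt =>
  dist_eq_one_of_mem_scaledPattern (by norm_num) sqNormInt_sub_hcpInt_dichotomy hx hy hxy hlt

/-! ## In the cuboctahedron every edge lies in exactly one triangle -/

/-- Unit distance in a scaled integer pattern is squared integer norm `N`. [folklore] -/
theorem sqNormInt_eq_of_dist_eq_one {N : ℕ} (hN : N ≠ 0) {v w : Fin 3 → ℤ}
    (h : dist ((Real.sqrt N)⁻¹ • intVec v : EuclideanSpace ℝ (Fin 3)) ((Real.sqrt N)⁻¹ • intVec w) = 1) :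
    sqNormInt (v - w) = N := by
  have hpos : (0 : ℝ) < Real.sqrt N := by positivity
  rw [dist_eq_norm, ← smul_sub, intVec_sub, norm_smul, norm_inv, Real.norm_of_nonneg hpos.le, norm_intVec,
    inv_mul_eq_one₀ hpos.ne'] at h
  have h0 : (0 : ℝ) ≤ (sqNormInt (v - w) : ℝ) := by
    have : (0 : ℤ) ≤ sqNormInt (v - w) := by unfold sqNormInt; positivity
    exact_mod_cast this
  have h2 : (N : ℝ) = (sqNormInt (v - w) : ℝ) := by
    have := congrArg (fun r : ℝ => r ^ 2) h
    simpa only [Real.sq_sqrt (Nat.cast_nonneg N), Real.sq_sqrt h0] using this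
  exact_mod_cast h2.symm

/-- In `fccInt`, two adjacent vectors have at most one common neighbour (by `decide`). [folklore] -/
theorem fccInt_edge_one_triangle : ∀ p ∈ fccInt, ∀ q ∈ fccInt, sqNormInt (p - q) = ((2 : ℕ) : ℤ) →
    ∀ r ∈ fccInt, sqNormInt (p - r) = ((2 : ℕ) : ℤ) → sqNormInt (q - r) = ((2 : ℕ) : ℤ) →
      ∀ s ∈ fccInt, sqNormInt (p - s) = ((2 : ℕ) : ℤ) → sqNormInt (q - s) = ((2 : ℕ) : ℤ) → r = s := by
  decide

/-- **In the FCC pattern (cuboctahedron) every edge lies in at most one triangle**: two touching points have at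
most one common touching point. [folklore] -/
theorem fcc_edge_one_triangle {x y r s : EuclideanSpace ℝ (Fin 3)} (hx : x ∈ fccKissingPattern)
    (hy : y ∈ fccKissingPattern) (hr : r ∈ fccKissingPattern) (hs : s ∈ fccKissingPattern) (hxy : dist x y = 1)
    (hxr : dist x r = 1) (hyr : dist y r = 1) (hxs : dist x s = 1) (hys : dist y s = 1) : r = s := by
  obtain ⟨p, hp, rfl⟩ := Finset.mem_image.1 hx
  obtain ⟨q, hq, rfl⟩ := Finset.mem_image.1 hy
  obtain ⟨r', hr', rfl⟩ := Finset.mem_image.1 hr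
  obtain ⟨s', hs', rfl⟩ := Finset.mem_image.1 hs
  rw [fccInt_edge_one_triangle p hp q hq (sqNormInt_eq_of_dist_eq_one two_ne_zero hxy) r' hr'
    (sqNormInt_eq_of_dist_eq_one two_ne_zero hxr) (sqNormInt_eq_of_dist_eq_one two_ne_zero hyr) s' hs'
    (sqNormInt_eq_of_dist_eq_one two_ne_zero hxs) (sqNormInt_eq_of_dist_eq_one two_ne_zero hys)]

/-! ## The HCP pattern is the ideal star, up to the hex↔cubic isometry -/

/-- The offset table of `HcpShells` lists star labels, with the letter shift equal to the layer parity
(by `decide`). [folklore] -/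
theorem hcpOffsetIdx_label : ∀ t ∈ hcpOffsetIdx,
    ((t.2.2.2, t.1, t.2.1) : ℤ × ℤ × ℤ) ∈ hcpStarIdx ∧ t.2.2.2 % 2 = t.2.2.1 := by
  decide

/-- **`hexIso` carries each point of the HCP kissing pattern to an ideal star strut** `hcpSite 1 √(2/3) v`,
`v ∈ hcpStarIdx`. [folklore] -/
theorem exists_label_of_mem_hcpKissingPattern {q : EuclideanSpace ℝ (Fin 3)} (hq : q ∈ hcpKissingPattern) :
    ∃ v ∈ hcpStarIdx, hexIso q = hcpSite 1 (Real.sqrt (2 / 3)) v := by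
  obtain ⟨t, ht, hM⟩ := hexIso_hcpPattern q hq
  obtain ⟨hmem, hmod⟩ := hcpOffsetIdx_label t ht
  refine ⟨_, hmem, ?_⟩
  rw [hM]
  unfold hcpSite barlowPos
  dsimp only
  rw [haggLabel_alternating_eq_emod, hmod]

/-! ## Aligning the unlabelled matching of the good shell with the chart -/

/-- **Matched labels.** Let `X` be a labelled chart (ideal unit struts ↔ bonds `0 < dist ≤ 28/25`) whose star atoms
`X v`, `v ∈ hcpStarIdx`, lie in a finite set `T` which is `(a/100)`-matched to `A (a • P)` for a pattern `P` with
distances `1` or `≥ √2` between distinct points, `a ∈ [9/10, 1]`.  Then there is `φ` with `φ v ∈ P`,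
`dist (X v) (A (a • φ v)) ≤ a/100`, injective on `hcpStarIdx`, and with
`dist (φ v) (φ w) = 1 ↔ dist (Pᵢ v) (Pᵢ w) = 1` (a contact-graph isomorphism onto its image). [folklore] -/
theorem matched_labels {X : ℤ × ℤ × ℤ → EuclideanSpace ℝ (Fin 3)} {a : ℝ} {T P : Finset (EuclideanSpace ℝ (Fin 3))}
    {A : EuclideanSpace ℝ (Fin 3) →ₗᵢ[ℝ] EuclideanSpace ℝ (Fin 3)}
    (hchart : ∀ u w, dist (hcpSite 1 (Real.sqrt (2 / 3)) u) (hcpSite 1 (Real.sqrt (2 / 3)) w) = 1 ↔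
      0 < dist (X u) (X w) ∧ dist (X u) (X w) ≤ 28 / 25)
    (h9 : 9 / 10 ≤ a) (h1 : a ≤ 1) (hXT : ∀ v ∈ hcpStarIdx, X v ∈ T)
    (hP2 : ∀ p ∈ P, ∀ q ∈ P, p ≠ q → dist p q < Real.sqrt 2 → dist p q = 1)
    (he : EtaMatched (a / 100) T ((P.image fun v : EuclideanSpace ℝ (Fin 3) => a • v).image A)) :
    ∃ φ : ℤ × ℤ × ℤ → EuclideanSpace ℝ (Fin 3), (∀ v ∈ hcpStarIdx, φ v ∈ P) ∧
      (∀ v ∈ hcpStarIdx, dist (X v) (A (a • φ v)) ≤ a / 100) ∧ Set.InjOn φ ↑hcpStarIdx ∧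
      ∀ v ∈ hcpStarIdx, ∀ w ∈ hcpStarIdx, (dist (φ v) (φ w) = 1 ↔
        dist (hcpSite 1 (Real.sqrt (2 / 3)) v) (hcpSite 1 (Real.sqrt (2 / 3)) w) = 1) := by
  obtain ⟨e, he⟩ := he
  have key : ∀ v (hv : v ∈ hcpStarIdx), ∃ p ∈ P,
      (e ⟨X v, hXT v hv⟩ : EuclideanSpace ℝ (Fin 3)) = A (a • p) := by
    intro v hv
    obtain ⟨p', hp', hAp⟩ := Finset.mem_image.1 (e ⟨X v, hXT v hv⟩).2
    obtain ⟨p, hp, rfl⟩ := Finset.mem_image.1 hp'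
    exact ⟨p, hp, hAp.symm⟩
  choose! φ hφP hφe using key
  have hφd : ∀ v ∈ hcpStarIdx, dist (X v) (A (a • φ v)) ≤ a / 100 := fun v hv => by
    rw [← hφe v hv]; exact he ⟨X v, hXT v hv⟩
  have hinj : Set.InjOn φ ↑hcpStarIdx := by
    intro v hv w hw hvw
    have h1 : (e ⟨X v, hXT v hv⟩ : EuclideanSpace ℝ (Fin 3)) = e ⟨X w, hXT w hw⟩ := by
      rw [hφe v hv, hφe w hw, hvw]
    have h2 : (⟨X v, hXT v hv⟩ : ↥T) = ⟨X w, hXT w hw⟩ := e.injective (Subtype.ext h1)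
    exact RootedChartUnique.chart_injective hchart (congrArg Subtype.val h2)
  have hAd : ∀ v w, dist (A (a • φ v)) (A (a • φ w)) = a * dist (φ v) (φ w) := fun v w => by
    rw [LinearIsometry.dist_map, dist_smul₀, Real.norm_of_nonneg (by linarith)]
  refine ⟨φ, hφP, hφd, hinj, fun v hv w hw => ⟨fun hd1 => ?_, fun hvw1 => ?_⟩⟩
  · -- touching pattern points come from bonded labels
    by_contra hne1
    have hvw : v ≠ w := by rintro rfl; simp at hd1
    have hXne : X v ≠ X w := fun h => hvw (RootedChartUnique.chart_injective hchart h)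
    have hgt : 28 / 25 < dist (X v) (X w) := by
      by_contra hle
      exact hne1 ((hchart v w).2 ⟨dist_pos.2 hXne, not_lt.1 hle⟩)
    have htri : dist (X v) (X w) ≤
        dist (X v) (A (a • φ v)) + dist (A (a • φ v)) (A (a • φ w)) + dist (A (a • φ w)) (X w) :=
      dist_triangle4 _ _ _ _
    rw [hAd, hd1, mul_one, dist_comm (A (a • φ w))] at htri
    linarith [hφd v hv, hφd w hw]
  · -- bonded labels go to touching pattern points
    obtain ⟨hpos, hle⟩ := (hchart v w).1 hvw1
    have hvw : v ≠ w := by rintro rfl; simp at hpos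
    have hφne : φ v ≠ φ w := fun h => hvw (hinj hv hw h)
    have htri : dist (A (a • φ v)) (A (a • φ w)) ≤
        dist (A (a • φ v)) (X v) + dist (X v) (X w) + dist (X w) (A (a • φ w)) := dist_triangle4 _ _ _ _
    rw [hAd, dist_comm (A (a • φ v)) (X v)] at htri
    have hd : a * dist (φ v) (φ w) ≤ 28 / 25 + a / 50 := by linarith [hφd v hv, hφd w hw]
    have h127 : dist (φ v) (φ w) < 127 / 100 := by
      by_contra hge
      rw [not_lt] at hge
      have : a * (127 / 100) ≤ a * dist (φ v) (φ w) := mul_le_mul_of_nonneg_left hge (by linarith)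
      linarith
    have hlt : dist (φ v) (φ w) < Real.sqrt 2 :=
      h127.trans (by rw [Real.lt_sqrt (by norm_num)]; norm_num)
    exact hP2 _ (hφP v hv) _ (hφP w hw) hφne hlt

/-! ## The registered stub -/

/-- The edge `{(0,1,0), (0,0,1)}` of the ideal hcp star lies in the two triangles through `(1,0,0)` and `(-1,0,0)`
(ideal unit distances, by `decide` on the integer metric). [folklore] -/
theorem ideal_edge_two_triangles :
    dist (hcpSite 1 (Real.sqrt (2 / 3)) (0, 1, 0)) (hcpSite 1 (Real.sqrt (2 / 3)) (0, 0, 1)) = 1 ∧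
    dist (hcpSite 1 (Real.sqrt (2 / 3)) (0, 1, 0)) (hcpSite 1 (Real.sqrt (2 / 3)) (1, 0, 0)) = 1 ∧
    dist (hcpSite 1 (Real.sqrt (2 / 3)) (0, 0, 1)) (hcpSite 1 (Real.sqrt (2 / 3)) (1, 0, 0)) = 1 ∧
    dist (hcpSite 1 (Real.sqrt (2 / 3)) (0, 1, 0)) (hcpSite 1 (Real.sqrt (2 / 3)) (-1, 0, 0)) = 1 ∧
    dist (hcpSite 1 (Real.sqrt (2 / 3)) (0, 0, 1)) (hcpSite 1 (Real.sqrt (2 / 3)) (-1, 0, 0)) = 1 :=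
  ⟨(dist_ideal_eq_one_iff _ _).2 (by decide), (dist_ideal_eq_one_iff _ _).2 (by decide),
    (dist_ideal_eq_one_iff _ _).2 (by decide), (dist_ideal_eq_one_iff _ _).2 (by decide),
    (dist_ideal_eq_one_iff _ _).2 (by decide)⟩

/-- **Registered sub-goal `tube_chartStarFrame`: the labelled star of a rooted chart is near a rotated scaled ideal
star, label by label.**  For every-point-good `S` and a rooted labelled chart `X` of `S` there are `a ∈ [9/10, 1]`
(the scale of the good shell of the root) and a linear isometry `A` with `‖X v − a • A (Pᵢ v)‖ ≤ a/100` for all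
twelve star labels `v` (`Pᵢ = hcpSite 1 √(2/3)`).  The good shell of the root is matched to a rotated scaled fcc or
hcp kissing pattern; the chart makes the matching a contact-graph isomorphism (`matched_labels`); fcc is excluded
(`fcc_edge_one_triangle`); for hcp the induced relabelling is an isometry of the ideal star
(`stub_localCongruenceStarAut`) and the frame is read off three independent struts.  (`HcpCharted S` is implied by
the chart and not used.) [folklore] -/
theorem tube_chartStarFrame : ∀ (S : Set (EuclideanSpace ℝ (Fin 3))), (∀ x ∈ S, GoodShell S x) → HcpCharted S → ∀ X : ℤ × ℤ × ℤ → EuclideanSpace ℝ (Fin 3), IsRootedChart S X → ∃ a : ℝ, 9 / 10 ≤ a ∧ a ≤ 1 ∧ ∃ A : EuclideanSpace ℝ (Fin 3) ≃ₗᵢ[ℝ] EuclideanSpace ℝ (Fin 3), ∀ v ∈ hcpStarIdx, ‖X v - a • A (hcpSite 1 (Real.sqrt (2 / 3)) v)‖ ≤ a / 100 := by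
  intro S hgood _ X hX
  obtain ⟨hX0, hXS, -, hchart⟩ := hX
  have h0S : (0 : EuclideanSpace ℝ (Fin 3)) ∈ S := hX0 ▸ hXS 0
  obtain ⟨a, h9, h1, T, hT, hclose⟩ := hgood 0 h0S
  -- the chart's star atoms lie in the shell of the root
  have hXT : ∀ v ∈ hcpStarIdx, X v ∈ T := by
    intro v hv
    have hd1 : dist (hcpSite 1 (Real.sqrt (2 / 3)) 0) (hcpSite 1 (Real.sqrt (2 / 3)) v) = 1 :=
      (dist_ideal_eq_one_iff_nbr 0 v).2 ⟨v, hv, (RootedChartUnique.nbr_zero v).symm⟩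
    obtain ⟨hpos, hle⟩ := (hchart 0 v).1 hd1
    rw [hX0] at hpos hle
    have hne : X v ≠ 0 := by
      intro h; rw [h, dist_self] at hpos; exact lt_irrefl _ hpos
    rw [← Finset.mem_coe, hT]
    refine ⟨X v, ⟨hXS v, hne, ?_⟩, sub_zero _⟩
    rw [dist_comm] at hle
    linarith
  refine ⟨a, h9, h1, ?_⟩
  rcases hclose with ⟨A, he⟩ | ⟨A, he⟩
  · -- the fcc pattern: the edge `{(0,1,0), (0,0,1)}` of the ideal star lies in two triangles
    exfalso
    obtain ⟨φ, hφP, -, hinj, hadj⟩ := matched_labels hchart h9 h1 hXT fcc_dist_eq_one he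
    have m0 : ((0, 1, 0) : ℤ × ℤ × ℤ) ∈ hcpStarIdx := by decide
    have m1 : ((0, 0, 1) : ℤ × ℤ × ℤ) ∈ hcpStarIdx := by decide
    have m2 : ((1, 0, 0) : ℤ × ℤ × ℤ) ∈ hcpStarIdx := by decide
    have m3 : ((-1, 0, 0) : ℤ × ℤ × ℤ) ∈ hcpStarIdx := by decide
    obtain ⟨d01, d02, d12, d03, d13⟩ := ideal_edge_two_triangles
    have heq : φ (1, 0, 0) = φ (-1, 0, 0) :=
      fcc_edge_one_triangle (hφP _ m0) (hφP _ m1) (hφP _ m2) (hφP _ m3) ((hadj _ m0 _ m1).2 d01)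
        ((hadj _ m0 _ m2).2 d02) ((hadj _ m1 _ m2).2 d12) ((hadj _ m0 _ m3).2 d03) ((hadj _ m1 _ m3).2 d13)
    exact absurd (hinj m2 m3 heq) (by decide)
  · -- the hcp pattern: the induced relabelling is an automorphism of the contact graph of the star
    obtain ⟨φ, hφP, hφd, hinj, hadj⟩ := matched_labels hchart h9 h1 hXT hcp_dist_eq_one he
    have hψ : ∀ v ∈ hcpStarIdx, ∃ w ∈ hcpStarIdx, hexIso (φ v) = hcpSite 1 (Real.sqrt (2 / 3)) w := fun v hv =>
      exists_label_of_mem_hcpKissingPattern (hφP v hv)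
    choose! π hπmem hπeq using hψ
    have hπinj : Set.InjOn π ↑hcpStarIdx := by
      intro v hv w hw hvw
      have h : hexIso (φ v) = hexIso (φ w) := by rw [hπeq v hv, hπeq w hw, hvw]
      exact hinj hv hw (hexIso.injective h)
    have hπmaps : Set.MapsTo π ↑hcpStarIdx ↑hcpStarIdx := fun v hv => hπmem v hv
    have hπadj : ∀ v ∈ hcpStarIdx, ∀ w ∈ hcpStarIdx,
        (dist (hcpSite 1 (Real.sqrt (2 / 3)) (π v)) (hcpSite 1 (Real.sqrt (2 / 3)) (π w)) = 1 ↔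
          dist (hcpSite 1 (Real.sqrt (2 / 3)) v) (hcpSite 1 (Real.sqrt (2 / 3)) w) = 1) := by
      intro v hv w hw
      rw [← hπeq v hv, ← hπeq w hw, hexIso.dist_map]
      exact hadj v hv w hw
    have haut := stub_localCongruenceStarAut 1 (Real.sqrt (2 / 3)) π hπinj hπmaps hπadj
    -- the labelled pattern has the metric of the ideal star
    have hzd : ∀ v ∈ hcpStarIdx, ∀ w ∈ hcpStarIdx,
        dist (hcpSite 1 (Real.sqrt (2 / 3)) v) (hcpSite 1 (Real.sqrt (2 / 3)) w) = dist (φ v) (φ w) := by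
      intro v hv w hw
      rw [← (haut v hv w hw).1, ← hπeq v hv, ← hπeq w hw, hexIso.dist_map]
    have hzn : ∀ v ∈ hcpStarIdx, ‖hcpSite 1 (Real.sqrt (2 / 3)) v‖ = ‖φ v‖ := by
      intro v hv
      rw [← (haut v hv v hv).2, ← hπeq v hv, hexIso.norm_map]
    have hinner : ∀ v ∈ hcpStarIdx, ∀ w ∈ hcpStarIdx,
        ⟪hcpSite 1 (Real.sqrt (2 / 3)) v, hcpSite 1 (Real.sqrt (2 / 3)) w⟫ = ⟪φ v, φ w⟫ := fun v hv w hw =>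
      inner_eq_of_norm_eq_of_dist_eq (hzn v hv) (hzn w hw) (hzd v hv w hw)
    -- a linear isometry from three independent struts
    have hh0 : Real.sqrt (2 / 3) ≠ 0 := by positivity
    have m0 : ((0, 1, 0) : ℤ × ℤ × ℤ) ∈ hcpStarIdx := by decide
    have m1 : ((0, 0, 1) : ℤ × ℤ × ℤ) ∈ hcpStarIdx := by decide
    have m2 : ((1, 0, 0) : ℤ × ℤ × ℤ) ∈ hcpStarIdx := by decide
    set p : Fin 3 → EuclideanSpace ℝ (Fin 3) := ![hcpSite 1 (Real.sqrt (2 / 3)) (0, 1, 0),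
      hcpSite 1 (Real.sqrt (2 / 3)) (0, 0, 1), hcpSite 1 (Real.sqrt (2 / 3)) (1, 0, 0)] with hp
    set q : Fin 3 → EuclideanSpace ℝ (Fin 3) := ![φ (0, 1, 0), φ (0, 0, 1), φ (1, 0, 0)] with hq
    have hli : LinearIndependent ℝ p := linearIndependent_three_struts one_ne_zero hh0
    have hpq : ∀ i j, ⟪p i, p j⟫ = ⟪q i, q j⟫ := by
      intro i j
      fin_cases i <;> fin_cases j <;>
        simp only [hp, hq, Fin.zero_eta, Fin.mk_one, Fin.reduceFinMk, Matrix.cons_val_zero,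
          Matrix.cons_val_one, Matrix.cons_val] <;> exact hinner _ (by decide) _ (by decide)
    obtain ⟨R₀, hR₀⟩ := exists_linearIsometry_of_inner_eq hli hpq
    set R : EuclideanSpace ℝ (Fin 3) ≃ₗᵢ[ℝ] EuclideanSpace ℝ (Fin 3) := R₀.toLinearIsometryEquiv rfl with hR
    have hRp : ∀ i, R (p i) = q i := fun i => by rw [hR, LinearIsometry.coe_toLinearIsometryEquiv]; exact hR₀ i
    have hlq : LinearIndependent ℝ q := by
      have h := hli.map' R.toLinearEquiv.toLinearMap R.toLinearEquiv.ker
      have hfun : ⇑R.toLinearEquiv.toLinearMap ∘ p = q := by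
        funext i; exact hRp i
      rw [hfun] at h
      exact h
    have hRε : ∀ ε ∈ hcpStarIdx, R (hcpSite 1 (Real.sqrt (2 / 3)) ε) = φ ε := by
      intro ε hε
      rw [← sub_eq_zero]
      refine eq_zero_of_inner_linearIndependent_fin_three hlq fun i => ?_
      rw [inner_sub_left, sub_eq_zero, ← hRp i, R.inner_map_map, hRp i]
      fin_cases i
      · simpa [hp, hq] using hinner ε hε _ m0
      · simpa [hp, hq] using hinner ε hε _ m1
      · simpa [hp, hq] using hinner ε hε _ m2
    -- the frame
    set A' : EuclideanSpace ℝ (Fin 3) ≃ₗᵢ[ℝ] EuclideanSpace ℝ (Fin 3) := A.toLinearIsometryEquiv rfl with hA'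
    refine ⟨R.trans A', fun v hv => ?_⟩
    have h := hφd v hv
    rw [dist_eq_norm, map_smul] at h
    rw [LinearIsometryEquiv.trans_apply, hRε v hv, hA', LinearIsometry.coe_toLinearIsometryEquiv]
    exact h

end Summit.AtomisticToContinuum.Crystallization.Theorems.PalmUnimodularRigidity.LayeredLawsSelectHcp

end
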